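import Mathlib.Combinatorics.SimpleGraph.Maps
import Mathlib.Data.Fintype.Card
import Mathlib.Data.Finset.Card
import Mathlib.Logic.Function.Iterate
import Literature.Combinatorics.SimpleGraph.ColourRefinementCanonical
import HarnessLib

/-!
# Ordered colour refinement from an arbitrary colouring stabilises and is then equitable

`ColourRefinementCanonical.lean` proves stabilisation within `|V| - 1` rounds for ordered colour
refinement started from the UNIFORM colouring (`ocr G t`). Individualization–refinement
algorithms (McKay–Piperno's `R(G, π, ν)`, Corneil–Goldberg's recursion tree) restart the
refinement from ARBITRARY colourings; this file redoes the (identical) argument for the iterates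
`ocrIter G col t = (ocrStep G)^[t] col` of any `col : V → ℕ`:

* `iterClasses_mono`, `iterClasses_lt_of_not_stable`, `iterClasses_le_card`: the number of
  colours is non-decreasing, increases at every unstable round, and is at most `|V|`;
* `iterStable_succ`: once a round splits nothing, no later round does;
* `iterStable_of_card_le`: round `t` is stable as soon as `|V| ≤ t + 1`;
* `isEquitable_of_ocrStep_ker`: a colouring whose classes `ocrStep` does not split is
  EQUITABLE (`IsEquitable`); hence **`isEquitable_ocrIter`**: `ocrIter G col t` is equitable for
  `|V| ≤ t + 1` — in particular `|V|` rounds always suffice;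
* `ocrIter_ker_of_le` : later rounds refine earlier ones; `ocrIter_comap`: label-invariance is
  inherited round by round from a label-invariance hypothesis on `ocrStep` (supplied for `Fin k`
  by `ColourRefinementScheme.ocrStep_comap`).

## References

* S. Kiefer, B. D. McKay, *The iteration number of colour refinement*, ICALP 2020, Def. 3,
  Cor. 6. [KieferMcKay2020]
* B. D. McKay, A. Piperno, *Practical graph isomorphism II*, J. Symb. Comput. 60 (2014), §2.3
  (refinement functions produce equitable colourings). [MckayPiperno2014]
-/

namespace Literature.Combinatorics.SimpleGraph

open _root_.SimpleGraph Finset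

universe u

variable {V : Type u} [Fintype V] {G : _root_.SimpleGraph V} [DecidableRel G.Adj]

/-- Round `t` of ordered colour refinement started from `col`. [cite: KieferMcKay2020, Def. 3] -/
def ocrIter (G : _root_.SimpleGraph V) [DecidableRel G.Adj] (col : V → ℕ) (t : ℕ) : V → ℕ :=
  (ocrStep G)^[t] col

/-- Round `0` is the start. [folklore] -/
@[simp] theorem ocrIter_zero (col : V → ℕ) : ocrIter G col 0 = col := rfl

/-- The next round is one `ocrStep`. [folklore] -/
theorem ocrIter_succ (col : V → ℕ) (t : ℕ) : ocrIter G col (t + 1) = ocrStep G (ocrIter G col t) := by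
  unfold ocrIter
  rw [Function.iterate_succ_apply']

/-- Each round refines the previous one. [folklore] -/
theorem ocrIter_eq_of_succ_eq {col : V → ℕ} {t : ℕ} {u v : V}
    (h : ocrIter G col (t + 1) u = ocrIter G col (t + 1) v) : ocrIter G col t u = ocrIter G col t v := by
  rw [ocrIter_succ] at h
  exact eq_of_ocrStep_eq h

/-- Later rounds refine earlier rounds. [folklore] -/
theorem ocrIter_ker_of_le {col : V → ℕ} {s t : ℕ} (hst : s ≤ t) {u v : V}
    (h : ocrIter G col t u = ocrIter G col t v) : ocrIter G col s u = ocrIter G col s v := by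
  induction t, hst using Nat.le_induction with
  | base => exact h
  | succ t _ ih => exact ih (ocrIter_eq_of_succ_eq h)

/-- The number of colours at round `t`. [folklore] -/
def iterClasses (G : _root_.SimpleGraph V) [DecidableRel G.Adj] (col : V → ℕ) (t : ℕ) : ℕ :=
  (univ.image (ocrIter G col t)).card

/-- The number of colours is non-decreasing. [cite: KieferMcKay2020, §3] -/
theorem iterClasses_mono (col : V → ℕ) (t : ℕ) : iterClasses G col t ≤ iterClasses G col (t + 1) :=
  (card_image_le_of_refines fun _ _ => ocrIter_eq_of_succ_eq).1

/-- An unstable round strictly increases the number of colours. [cite: KieferMcKay2020, §3] -/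
theorem iterClasses_lt_of_not_stable {col : V → ℕ} {t : ℕ}
    (h : ¬ ∀ u v : V, ocrIter G col (t + 1) u = ocrIter G col (t + 1) v ↔ ocrIter G col t u = ocrIter G col t v) :
    iterClasses G col t < iterClasses G col (t + 1) := by
  refine lt_of_le_of_ne (iterClasses_mono col t) fun heq => h fun u v => ?_
  exact ⟨ocrIter_eq_of_succ_eq,
    (card_image_le_of_refines fun _ _ => ocrIter_eq_of_succ_eq).2 heq.symm.le u v⟩

/-- The number of colours is between `1` (on a non-empty type) and `|V|`. [folklore] -/
theorem iterClasses_le_card (col : V → ℕ) (t : ℕ) : iterClasses G col t ≤ Fintype.card V :=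
  Finset.card_image_le.trans (by rw [Finset.card_univ])

/-- At least one colour on a non-empty type. [folklore] -/
theorem one_le_iterClasses [Nonempty V] (col : V → ℕ) (t : ℕ) : 1 ≤ iterClasses G col t :=
  card_pos.2 ⟨ocrIter G col t (Classical.arbitrary V), mem_image_of_mem _ (mem_univ _)⟩

/-- **Once stable, stable forever.** [cite: KieferMcKay2020, Def. 3 (stable colouring)] -/
theorem iterStable_succ {col : V → ℕ} {t : ℕ}
    (h : ∀ u v : V, ocrIter G col (t + 1) u = ocrIter G col (t + 1) v ↔ ocrIter G col t u = ocrIter G col t v) :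
    ∀ u v : V, ocrIter G col (t + 2) u = ocrIter G col (t + 2) v ↔ ocrIter G col (t + 1) u = ocrIter G col (t + 1) v := by
  intro u v
  have ho : ∀ a b : V, ocrIter G col (t + 1) a < ocrIter G col (t + 1) b ↔ ocrIter G col t a < ocrIter G col t b := by
    intro a b
    rw [ocrIter_succ]
    constructor
    · intro hab
      rcases lt_trichotomy (ocrIter G col t a) (ocrIter G col t b) with h' | h' | h'
      · exact h'
      · rw [← ocrIter_succ] at hab
        exact absurd ((h a b).2 h') hab.ne
      · exact absurd hab (not_lt.2 (ocrStep_lt_of_lt h').le)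
    · exact fun hab => ocrStep_lt_of_lt hab
  rw [show t + 2 = (t + 1) + 1 from rfl, ocrIter_succ col (t + 1)]
  rw [← ocrStep_congr (col := ocrIter G col t) (fun a b => (h a b).symm) (fun a b => (ho a b).symm) u,
    ← ocrStep_congr (col := ocrIter G col t) (fun a b => (h a b).symm) (fun a b => (ho a b).symm) v,
    ← ocrIter_succ]

/-- Stability persists to all later rounds. [folklore] -/
theorem iterStable_of_le {col : V → ℕ} {s t : ℕ} (hst : s ≤ t)
    (h : ∀ u v : V, ocrIter G col (s + 1) u = ocrIter G col (s + 1) v ↔ ocrIter G col s u = ocrIter G col s v) :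
    ∀ u v : V, ocrIter G col (t + 1) u = ocrIter G col (t + 1) v ↔ ocrIter G col t u = ocrIter G col t v := by
  induction t, hst using Nat.le_induction with
  | base => exact h
  | succ t _ ih => exact iterStable_succ ih

/-- **Stabilisation within `|V| - 1` rounds**: some round `t` with `t + 1 ≤ |V|` (or `t = 0`) splits
nothing. [cite: KieferMcKay2020, Cor. 6] -/
theorem exists_iterStable_le (col : V → ℕ) :
    ∃ t : ℕ, (t + 1 ≤ Fintype.card V ∨ t = 0) ∧
      ∀ u v : V, ocrIter G col (t + 1) u = ocrIter G col (t + 1) v ↔ ocrIter G col t u = ocrIter G col t v := by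
  rcases isEmpty_or_nonempty V with hV | hV
  · exact ⟨0, Or.inr rfl, fun u => (IsEmpty.false u).elim⟩
  by_contra hcon
  have hns : ∀ t : ℕ, (t + 1 ≤ Fintype.card V ∨ t = 0) →
      ¬ ∀ u v : V, ocrIter G col (t + 1) u = ocrIter G col (t + 1) v ↔ ocrIter G col t u = ocrIter G col t v :=
    fun t ht hst => hcon ⟨t, ht, hst⟩
  have hgrow : ∀ t : ℕ, t + 1 ≤ Fintype.card V → t + iterClasses G col 0 ≤ iterClasses G col t := by
    intro t
    induction t with
    | zero => intro; simp
    | succ t ih =>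
      intro ht
      have h1 := ih (by omega)
      have h2 := iterClasses_lt_of_not_stable (hns t (Or.inl (by omega)))
      omega
  have hcard : 1 ≤ Fintype.card V := Fintype.card_pos
  have h1 := hgrow (Fintype.card V - 1) (by omega)
  have h2 := iterClasses_lt_of_not_stable (hns (Fintype.card V - 1) (Or.inl (by omega)))
  have h3 := iterClasses_le_card (G := G) col (Fintype.card V - 1 + 1)
  have h4 := one_le_iterClasses (G := G) col 0
  omega

/-- Round `t` is stable whenever `|V| ≤ t + 1`. [cite: KieferMcKay2020, Cor. 6] -/
theorem iterStable_of_card_le (col : V → ℕ) {t : ℕ} (ht : Fintype.card V ≤ t + 1) :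
    ∀ u v : V, ocrIter G col (t + 1) u = ocrIter G col (t + 1) v ↔ ocrIter G col t u = ocrIter G col t v := by
  obtain ⟨s, hs, hstab⟩ := exists_iterStable_le (G := G) col
  exact iterStable_of_le (by omega) hstab

/-! ## Stable rounds are equitable -/

/-- **A colouring whose classes `ocrStep` does not split is equitable.** [cite: MckayPiperno2014, §2.3 (equitable colourings)] -/
theorem isEquitable_of_ocrStep_ker {col : V → ℕ}
    (h : ∀ u v : V, col u = col v → ocrStep G col u = ocrStep G col v) : IsEquitable G col := by
  intro u v huv y
  have hk := (ocrStep_eq_iff.1 (h u v huv)).2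
  by_cases hy : ∃ w, col w = y
  · obtain ⟨w, rfl⟩ := hy
    rw [natCard_subtype_eq_card_filter', natCard_subtype_eq_card_filter']
    exact hk w
  · push Not at hy
    haveI h₁ : IsEmpty {w : V // G.Adj u w ∧ col w = y} := ⟨fun w => hy w.1 w.2.2⟩
    haveI h₂ : IsEmpty {w : V // G.Adj v w ∧ col w = y} := ⟨fun w => hy w.1 w.2.2⟩
    rw [Nat.card_of_isEmpty, Nat.card_of_isEmpty]

/-- **Round `t` is equitable once `|V| ≤ t + 1`** — `|V|` rounds of ordered colour refinement from
ANY start produce an equitable colouring. [cite: KieferMcKay2020, Cor. 6] [cite: MckayPiperno2014, §2.3] -/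
theorem isEquitable_ocrIter (col : V → ℕ) {t : ℕ} (ht : Fintype.card V ≤ t + 1) :
    IsEquitable G (ocrIter G col t) := by
  refine isEquitable_of_ocrStep_ker fun u v huv => ?_
  rw [← ocrIter_succ]
  exact (iterStable_of_card_le col ht u v).2 huv

/-- Every round refines the start. [folklore] -/
theorem eq_of_ocrIter_eq {col : V → ℕ} {t : ℕ} {u v : V} (h : ocrIter G col t u = ocrIter G col t v) :
    col u = col v :=
  ocrIter_ker_of_le (Nat.zero_le t) h

end Literature.Combinatorics.SimpleGraph
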